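import Summits.ValiantsHypothesis.ValiantsHypothesis.Theorems.FreeSubtorusOrbitDimensionBoundStubPolystableModelComplement
import Summits.ValiantsHypothesis.ValiantsHypothesis.Theorems.FreeSubtorusOrbitDimensionBoundStubDiagonalLiftsSchurian

/-!
# `OrbitDimensionBound` (stmt-ValiantsHypothesis-16133), rung line `filtered_covering` — stub `stub_polystableModel`,
# part 2: the levels of a one-parameter degeneration of a semisimple pencil split

Helper file (part 2) for stub 1 `stub_polystableModel` of `Cruxes/OrbitDimensionBound/Lines/filtered_covering.lean`
(route `FreeSubtorus`).  Setting: a square polynomial matrix `X` with `det X ≠ 0` whose balanced sub-pencils are all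
COMPLEMENTED (the pencil is semisimple), and weights `a, b : Fin m → ℕ` with `X i j = 0` whenever `a i < b j`
(the gauge form of a one-parameter degeneration, `Lines/DepthLadder.lean :: IsDegeneration`; the truncation
`weightTruncate` is written out as `Matrix.of fun i j => if a i = b j then X i j else 0` and `det_weightTruncate` is re-proved as
`det_truncate`, so that this Theorems file imports no workfile).  The coordinate subspaces
`V_{≥w} = ⟨e_j : b j ≥ w⟩`, `W_{≥w} = ⟨e_i : a i ≥ w⟩` form a decreasing chain of BALANCED sub-pencils (`X V_{≥w} ⊆ W_{≥w}`;
the level counts agree because `det (weightTruncate a b X) = det X ≠ 0`).  Main result **`exists_level_splitting`**: there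
are balanced sub-pencils `C_w` (`w ≤ L`) with `V_{≥w} = C_w ⊕ V_{≥w+1}`, hence `ℂ^m = ⊕_w C_w` and `ℂ^m = ⊕_w W(C_w)`
internally, each `C_w` supported on the coordinates `b ≥ w` and meeting the coordinates `b > w` trivially (and dually for
`W(C_w)` and `a`).  Part 3 glues the coordinate projections of the `C_w` into a gauge equivalence between `X` and its
degeneration.

Helper mode (`--supports stmt-ValiantsHypothesis-16133 --as helper`).  Honest framing: [folklore] linear algebra toward
ONE registered stub (`stub_polystableModel`, L) of a dormant rung line; the crux `OrbitDimensionBound`, the route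
`FreeSubtorus` and VP ≠ VNP are OPEN and are not moved by this file.

## References (orientation only)
* A. D. King, Quart. J. Math. 45 (1994), §2–3 (one-parameter subgroups and filtrations; semisimple objects).
* G. Kempf, L. Ness (1979) — orientation for "closed orbit ⇔ degeneration-closed".
-/

set_option linter.dupNamespace false

namespace Summit.ValiantsHypothesis.ValiantsHypothesis.Theorems.FreeSubtorusOrbitDimensionBound.SquareCovering.StableReduction

open Matrix MvPolynomial Module
open Literature.Computability.AlgebraicComplexity
open Summit.ValiantsHypothesis.ValiantsHypothesis.Theorems.FreeSubtorusOrbitDimensionBound.SquareCovering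

/-! ### §1 Coordinate subspaces cut out by a predicate -/

section Coord

variable {m : ℕ}

/-- Membership in the coordinate subspace `⟨e_j : p j⟩`, realised as the range of the diagonal indicator matrix.
[folklore] -/
theorem mem_range_indicator_iff (p : Fin m → Prop) [DecidablePred p] (v : Fin m → ℂ) :
    v ∈ LinearMap.range (Matrix.toLin' (Matrix.diagonal fun j : Fin m => if p j then (1 : ℂ) else 0)) ↔
      ∀ j, ¬ p j → v j = 0 := by
  constructor
  · rintro ⟨u, rfl⟩ j hj
    rw [Matrix.toLin'_apply, Matrix.mulVec_diagonal, if_neg hj, zero_mul]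
  · intro hv
    refine ⟨v, ?_⟩
    ext j
    rw [Matrix.toLin'_apply, Matrix.mulVec_diagonal]
    by_cases hj : p j
    · rw [if_pos hj, one_mul]
    · rw [if_neg hj, zero_mul, hv j hj]

/-- The dimension of the coordinate subspace `⟨e_j : p j⟩` is the number of `j` with `p j`. [folklore] -/
theorem finrank_range_indicator (p : Fin m → Prop) [DecidablePred p] :
    finrank ℂ (LinearMap.range (Matrix.toLin' (Matrix.diagonal fun j : Fin m => if p j then (1 : ℂ) else 0))) =
      Fintype.card {j : Fin m // p j} := by
  classical
  have h := Matrix.rank_diagonal (fun j : Fin m => if p j then (1 : ℂ) else 0)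
  rw [Matrix.rank, ← Matrix.toLin'_apply'] at h
  rw [h]
  exact Fintype.card_congr (Equiv.subtypeEquivRight fun j => by simp)

end Coord

/-! ### §2 Weight truncation preserves the determinant -/

section Truncate

variable {R : Type*} [CommRing R] {m : ℕ}

/-- **The determinant is constant along a determinant-preserving one-parameter degeneration** (the statement of
`Lines/DepthLadder.lean :: det_weightTruncate`, re-proved here with the truncation `weightTruncate a b X` written out as
`Matrix.of fun i j => if a i = b j then X i j else 0`, so that no workfile is imported): if `X i j = 0` whenever `a i < b j`
and `Σ a = Σ b`, the weight-diagonal part of `X` has the same determinant. [folklore] -/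
theorem det_truncate (a b : Fin m → ℕ) (X : Matrix (Fin m) (Fin m) R)
    (hs : ∑ i, a i = ∑ j, b j) (hz : ∀ i j, a i < b j → X i j = 0) :
    (Matrix.of fun i j => if a i = b j then X i j else 0).det = X.det := by
  rw [Matrix.det_apply, Matrix.det_apply]
  refine Finset.sum_congr rfl fun σ _ => ?_
  congr 1
  by_cases hall : ∀ i, a (σ i) = b i
  · exact Finset.prod_congr rfl fun i _ => by simp [hall i]
  · push Not at hall
    obtain ⟨i₀, hi₀⟩ := hall
    have hL : (∏ i, (Matrix.of fun i j => if a i = b j then X i j else 0) (σ i) i) = 0 :=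
      Finset.prod_eq_zero (Finset.mem_univ i₀) (by simp [hi₀])
    have hR : (∏ i, X (σ i) i) = 0 := by
      by_contra hne
      have hge : ∀ i, b i ≤ a (σ i) := by
        intro i
        by_contra hlt
        push Not at hlt
        exact hne (Finset.prod_eq_zero (Finset.mem_univ i) (hz _ _ hlt))
      have hsum : ∑ i, b i = ∑ i, a (σ i) := by
        rw [Equiv.sum_comp σ a]; exact hs.symm
      have heq : ∀ i ∈ Finset.univ, b i = a (σ i) :=
        (Finset.sum_eq_sum_iff_of_le fun i _ => hge i).mp hsum
      exact hi₀ (heq i₀ (Finset.mem_univ _)).symm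
    rw [hL, hR]

end Truncate

/-! ### §3 The level splitting -/

section Levels

variable {σ : Type*} {m : ℕ}

/-- **Level splitting of a one-parameter degeneration of a semisimple pencil** (see the module docstring). [folklore] -/
theorem exists_level_splitting (X : Matrix (Fin m) (Fin m) (MvPolynomial σ ℂ)) (hX : X.det ≠ 0)
    (hcompl : ∀ U : Submodule ℂ (Fin m → ℂ),
      finrank ℂ ↥(⨆ e : σ →₀ ℕ, U.map (Matrix.toLin' (X.map (coeff e)))) ≤ finrank ℂ U →
      ∃ C : Submodule ℂ (Fin m → ℂ), finrank ℂ ↥(⨆ e : σ →₀ ℕ, C.map (Matrix.toLin' (X.map (coeff e)))) ≤ finrank ℂ C ∧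
        U ⊓ C = ⊥ ∧ U ⊔ C = ⊤)
    (a b : Fin m → ℕ) (hz : ∀ i j, a i < b j → X i j = 0) (hs : ∑ i, a i = ∑ j, b j)
    (L : ℕ) (hbL : ∀ j, b j ≤ L) :
    ∃ Cw : Fin (L + 1) → Submodule ℂ (Fin m → ℂ),
      (∀ w, finrank ℂ ↥(⨆ e : σ →₀ ℕ, (Cw w).map (Matrix.toLin' (X.map (coeff e)))) ≤ finrank ℂ (Cw w)) ∧
      (∀ w, ∀ v ∈ Cw w, ∀ j, b j < (w : ℕ) → v j = 0) ∧
      (∀ w, ∀ v ∈ Cw w, (∀ j, b j = (w : ℕ) → v j = 0) → v = 0) ∧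
      DirectSum.IsInternal Cw ∧
      DirectSum.IsInternal (fun w => ⨆ e : σ →₀ ℕ, (Cw w).map (Matrix.toLin' (X.map (coeff e)))) ∧
      (∀ w, ∀ u ∈ ⨆ e : σ →₀ ℕ, (Cw w).map (Matrix.toLin' (X.map (coeff e))), ∀ i, a i < (w : ℕ) → u i = 0) ∧
      (∀ w, ∀ u ∈ ⨆ e : σ →₀ ℕ, (Cw w).map (Matrix.toLin' (X.map (coeff e))), (∀ i, a i = (w : ℕ) → u i = 0) → u = 0) := by
  classical
  set F : (σ →₀ ℕ) → (Fin m → ℂ) →ₗ[ℂ] (Fin m → ℂ) := fun e => Matrix.toLin' (X.map (coeff e)) with hF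
  have hss : ∀ V : Submodule ℂ (Fin m → ℂ), finrank ℂ V ≤ finrank ℂ ↥(⨆ e, V.map (F e)) := by
    intro V
    by_contra hlt
    refine hX (det_eq_zero_of_subpencil X V (⨆ e, V.map (F e)) (fun e x hx => ?_) (not_le.1 hlt))
    exact Submodule.mem_iSup_of_mem e (Submodule.mem_map_of_mem hx)
  -- the coordinate subspaces
  let Vge : ℕ → Submodule ℂ (Fin m → ℂ) := fun w =>
    LinearMap.range (Matrix.toLin' (Matrix.diagonal fun j : Fin m => if w ≤ b j then (1 : ℂ) else 0))
  let Wge : ℕ → Submodule ℂ (Fin m → ℂ) := fun w =>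
    LinearMap.range (Matrix.toLin' (Matrix.diagonal fun i : Fin m => if w ≤ a i then (1 : ℂ) else 0))
  have hVge : ∀ w v, v ∈ Vge w ↔ ∀ j, b j < w → v j = 0 := fun w v => by
    rw [mem_range_indicator_iff]; simp only [not_le]
  have hWge : ∀ w u, u ∈ Wge w ↔ ∀ i, a i < w → u i = 0 := fun w u => by
    rw [mem_range_indicator_iff]; simp only [not_le]
  have hVge_fin : ∀ w, finrank ℂ (Vge w) = Fintype.card {j : Fin m // w ≤ b j} := fun w => finrank_range_indicator _
  have hWge_fin : ∀ w, finrank ℂ (Wge w) = Fintype.card {i : Fin m // w ≤ a i} := fun w => finrank_range_indicator _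
  -- `X_e` maps `V_{≥w}` into `W_{≥w}`
  have hsub : ∀ w e, (Vge w).map (F e) ≤ Wge w := by
    intro w e
    rintro _ ⟨v, hv, rfl⟩
    rw [hWge]
    intro i hi
    rw [SetLike.mem_coe, hVge] at hv
    change (Matrix.toLin' (X.map (coeff e))) v i = 0
    rw [Matrix.toLin'_apply, Matrix.mulVec, dotProduct]
    refine Finset.sum_eq_zero fun j _ => ?_
    by_cases hj : b j < w
    · rw [hv j hj, mul_zero]
    · rw [Matrix.map_apply, hz i j (by omega), coeff_zero, zero_mul]
  -- the degeneration `B = weightTruncate a b X` has `det ≠ 0`; its support forces the level counts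
  have hBdet : (Matrix.of fun i j => if a i = b j then X i j else 0).det ≠ 0 := by
    rw [det_truncate a b X hs hz]; exact hX
  have hcount : ∀ w, Fintype.card {i : Fin m // w ≤ a i} ≤ Fintype.card {j : Fin m // w ≤ b j} := by
    intro w
    -- `B` maps `⟨e_j : b j < w⟩` into `⟨e_i : a i < w⟩`
    have h1 : Fintype.card {j : Fin m // b j < w} ≤ Fintype.card {i : Fin m // a i < w} := by
      rw [← finrank_range_indicator (fun j : Fin m => b j < w), ← finrank_range_indicator (fun i : Fin m => a i < w)]
      by_contra hlt
      refine hBdet (det_eq_zero_of_subpencil (Matrix.of fun i j => if a i = b j then X i j else 0) _ _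
        (fun e v hv => ?_) (not_le.1 hlt))
      rw [mem_range_indicator_iff] at hv ⊢
      intro i hi
      rw [Matrix.toLin'_apply, Matrix.mulVec, dotProduct]
      refine Finset.sum_eq_zero fun j _ => ?_
      by_cases hj : b j < w
      · rw [Matrix.map_apply, Matrix.of_apply, if_neg (by omega), coeff_zero, zero_mul]
      · rw [hv j hj, mul_zero]
    have h2 := Fintype.card_subtype_compl (fun j : Fin m => b j < w)
    have h3 := Fintype.card_subtype_compl (fun i : Fin m => a i < w)
    have h4 : Fintype.card {j : Fin m // ¬ b j < w} = Fintype.card {j : Fin m // w ≤ b j} :=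
      Fintype.card_congr (Equiv.subtypeEquivRight fun j => not_lt)
    have h5 : Fintype.card {i : Fin m // ¬ a i < w} = Fintype.card {i : Fin m // w ≤ a i} :=
      Fintype.card_congr (Equiv.subtypeEquivRight fun i => not_lt)
    have h6 : Fintype.card {j : Fin m // b j < w} ≤ Fintype.card (Fin m) := Fintype.card_subtype_le _
    have h7 : Fintype.card {i : Fin m // a i < w} ≤ Fintype.card (Fin m) := Fintype.card_subtype_le _
    omega
  -- hence each `V_{≥w}` is balanced
  have hVbal : ∀ w, finrank ℂ ↥(⨆ e, (Vge w).map (F e)) ≤ finrank ℂ (Vge w) := by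
    intro w
    calc finrank ℂ ↥(⨆ e, (Vge w).map (F e)) ≤ finrank ℂ (Wge w) := Submodule.finrank_mono (iSup_le (hsub w))
      _ ≤ finrank ℂ (Vge w) := by rw [hVge_fin, hWge_fin]; exact hcount w
  have hVmono : ∀ w, Vge (w + 1) ≤ Vge w := fun w v hv => by
    rw [hVge] at hv ⊢; exact fun j hj => hv j (by omega)
  have hV0 : Vge 0 = ⊤ := by
    refine top_le_iff.1 fun v _ => ?_
    rw [hVge]; intro j hj; omega
  have hVtop : Vge (L + 1) = ⊥ := by
    refine le_bot_iff.1 fun v hv => ?_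
    rw [hVge] at hv
    rw [Submodule.mem_bot]
    exact funext fun j => hv j (by have := hbL j; omega)
  -- relative complements level by level
  have hrel : ∀ w : ℕ, ∃ C : Submodule ℂ (Fin m → ℂ), finrank ℂ ↥(⨆ e, C.map (F e)) ≤ finrank ℂ C ∧
      C ≤ Vge w ∧ Vge (w + 1) ⊓ C = ⊥ ∧ Vge (w + 1) ⊔ C = Vge w := fun w =>
    exists_balanced_compl_between F hss hcompl (hVbal (w + 1)) (hVbal w) (hVmono w)
  choose C hCbal hCle hCinf hCsup using hrel
  -- the direct sum `⊕_{w ≤ L} C_w = ⊤`, by descending induction on the level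
  have hchain : ∀ k : ℕ, k ≤ L + 1 →
      Vge (L + 1 - k) = (⨆ w ∈ Finset.Ico (L + 1 - k) (L + 1), C w) ∧
      finrank ℂ (Vge (L + 1 - k)) = ∑ w ∈ Finset.Ico (L + 1 - k) (L + 1), finrank ℂ (C w) := by
    intro k
    induction k with
    | zero =>
      intro _
      rw [Nat.sub_zero, Finset.Ico_self, hVtop]
      simp
    | succ k ih =>
      intro hk
      obtain ⟨ih1, ih2⟩ := ih (by omega)
      have hw : L + 1 - k = (L - k) + 1 := by omega
      rw [show L + 1 - (k + 1) = L - k by omega]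
      rw [hw] at ih1 ih2
      have hIco : Finset.Ico (L - k) (L + 1) = insert (L - k) (Finset.Ico (L - k + 1) (L + 1)) :=
        (Finset.insert_Ico_add_one_left_eq_Ico (by omega)).symm
      have hnot : L - k ∉ Finset.Ico (L - k + 1) (L + 1) := by simp
      refine ⟨?_, ?_⟩
      · rw [← hCsup (L - k), ih1, hIco, Finset.iSup_insert, sup_comm]
      · rw [hIco, Finset.sum_insert hnot, ← ih2, ← hCsup (L - k)]
        have h1 := Submodule.finrank_sup_add_finrank_inf_eq (Vge (L - k + 1)) (C (L - k))
        rw [hCinf, finrank_bot, add_zero] at h1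
        rw [h1, add_comm]
  obtain ⟨htop, hsum⟩ := hchain (L + 1) le_rfl
  rw [Nat.sub_self, hV0, ← Finset.range_eq_Ico] at htop hsum
  rw [finrank_top, finrank_fin_fun] at hsum
  -- `dim (W V ⊓ W V') = dim (V ⊓ V')` for balanced `V, V'`
  have hWinf : ∀ V V' : Submodule ℂ (Fin m → ℂ), finrank ℂ ↥(⨆ e, V.map (F e)) ≤ finrank ℂ V →
      finrank ℂ ↥(⨆ e, V'.map (F e)) ≤ finrank ℂ V' →
      finrank ℂ ↥((⨆ e, V.map (F e)) ⊓ ⨆ e, V'.map (F e)) = finrank ℂ ↥(V ⊓ V') := by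
    intro V V' hV hV'
    have h1 := balanced_sup F hss hV hV'
    rw [iSup_map_sup] at h1
    have h2 := hss (V ⊔ V')
    rw [iSup_map_sup] at h2
    have h3 := Submodule.finrank_sup_add_finrank_inf_eq V V'
    have h4 := Submodule.finrank_sup_add_finrank_inf_eq (⨆ e, V.map (F e)) (⨆ e, V'.map (F e))
    have h5 := hss V
    have h6 := hss V'
    omega
  -- `W(V_{≥w+1}) = W_{≥w+1}`
  have hWVge : ∀ w, (⨆ e, (Vge w).map (F e)) = Wge w := fun w =>
    Submodule.eq_of_le_of_finrank_le (iSup_le (hsub w)) (by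
      rw [hWge_fin]
      calc Fintype.card {i : Fin m // w ≤ a i} ≤ Fintype.card {j : Fin m // w ≤ b j} := hcount w
        _ = finrank ℂ (Vge w) := (hVge_fin w).symm
        _ ≤ _ := hss _)
  refine ⟨fun w => C w, fun w => hCbal w, fun w v hv j hj => (hVge w v).1 (hCle w hv) j hj, fun w v hv hv0 => ?_,
    ?_, ?_, fun w u hu i hi => ?_, fun w u hu hu0 => ?_⟩
  · -- `C_w ⊓ V_{≥w+1} = ⊥`
    have h1 : v ∈ Vge (w + 1) := by
      rw [hVge]; intro j hj
      by_cases hj' : b j = w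
      · exact hv0 j hj'
      · exact (hVge w v).1 (hCle w hv) j (by omega)
    have h2 : v ∈ Vge ((w : ℕ) + 1) ⊓ C w := ⟨h1, hv⟩
    rw [hCinf] at h2
    exact (Submodule.mem_bot ℂ).1 h2
  · -- `⊕_w C_w = ⊤`
    refine isInternal_of_iSup_eq_top_of_sum_finrank_eq _ ?_ ?_
    · refine top_le_iff.1 ?_
      rw [htop]
      exact iSup₂_le fun w hw => le_iSup (fun i : Fin (L + 1) => C i) ⟨w, Finset.mem_range.1 hw⟩
    · rw [finrank_fin_fun]
      exact (Fin.sum_univ_eq_sum_range (fun w => finrank ℂ (C w)) (L + 1)).trans hsum.symm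
  · -- `⊕_w W(C_w) = ⊤`
    refine isInternal_of_iSup_eq_top_of_sum_finrank_eq _ ?_ ?_
    · have h1 : (⨆ i : Fin (L + 1), ⨆ e, (C i).map (F e)) = ⨆ e, (⨆ i : Fin (L + 1), C (i : ℕ)).map (F e) := by
        rw [iSup_comm]
        exact iSup_congr fun e => (Submodule.map_iSup _ _).symm
      have h2 : (⨆ i : Fin (L + 1), C (i : ℕ)) = ⊤ := by
        refine top_le_iff.1 ?_
        rw [htop]
        exact iSup₂_le fun w hw => le_iSup (fun i : Fin (L + 1) => C i) ⟨w, Finset.mem_range.1 hw⟩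
      rw [h1, h2]
      refine Submodule.eq_top_of_finrank_eq (le_antisymm (Submodule.finrank_le _) ?_)
      rw [← finrank_top ℂ (Fin m → ℂ)]
      exact hss ⊤
    · rw [finrank_fin_fun]
      calc ∑ i : Fin (L + 1), finrank ℂ ↥(⨆ e, (C (i : ℕ)).map (F e)) = ∑ i : Fin (L + 1), finrank ℂ (C (i : ℕ)) :=
            Finset.sum_congr rfl fun i _ => le_antisymm (hCbal i) (hss _)
        _ = m := (Fin.sum_univ_eq_sum_range (fun w => finrank ℂ (C w)) (L + 1)).trans hsum.symm
  · -- `W(C_w) ≤ W_{≥w}`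
    have h1 : u ∈ Wge w := by
      rw [← hWVge]
      exact iSup_map_mono F (hCle w) hu
    exact (hWge w u).1 h1 i hi
  · -- `W(C_w) ⊓ W_{≥w+1} = ⊥`
    have h1 : u ∈ Wge (w + 1) := by
      rw [hWge]; intro i hi
      by_cases hi' : a i = w
      · exact hu0 i hi'
      · have h2 : u ∈ Wge w := by rw [← hWVge]; exact iSup_map_mono F (hCle w) hu
        exact (hWge w u).1 h2 i (by omega)
    rw [← hWVge] at h1
    have h3 : finrank ℂ ↥((⨆ e, (C w).map (F e)) ⊓ ⨆ e, (Vge (w + 1)).map (F e)) = 0 := by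
      rw [hWinf _ _ (hCbal w) (hVbal (w + 1)), inf_comm, hCinf, finrank_bot]
    have h4 := Submodule.finrank_eq_zero.1 h3
    have h5 : u ∈ (⨆ e, (C w).map (F e)) ⊓ ⨆ e, (Vge (w + 1)).map (F e) := ⟨hu, h1⟩
    rw [h4] at h5
    exact (Submodule.mem_bot ℂ).1 h5

end Levels

end Summit.ValiantsHypothesis.ValiantsHypothesis.Theorems.FreeSubtorusOrbitDimensionBound.SquareCovering.StableReduction
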